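import Summits.QuantumFields.BalabanUV.T4Continuum.Support.NE7FibreStraightening
import Summits.QuantumFields.BalabanUV.T4Continuum.Support.NE7SecondOrderChainRuleVec
import HarnessLib

/-!
# NE7ConstraintSecondDerivativeRecursion — THE SECOND DERIVATIVE OF THE MULTI-LEVEL CONSTRAINT MAP `𝒢_{j,U} = levelQ L N j U ∘ chart_U` ALONG THE TOWER:
# `D²𝒢_{0,U}(0)[ψ,ψ′] = skewPR (D²coord_U(0)[ψ,ψ′])` and `D²𝒢_{j+1,U}(0)[ψ,ψ′] = D²𝒢_{j,Ū}(0)[T_U ψ, T_U ψ′] + levelQ′ L N j Ū (D²coord_U(0)[ψ,ψ′])`,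
# `Ū = cavg L U`, `T_U = D coord_U(0)` — the curvature of the `(j+2)`-fold constraint is the curvature of the `(j+1)`-fold one at the averaged base along the linearised one-step
# average PLUS the one-step curvature pushed through the remaining linearised tower (ROAD-G116 §6 (G3), kinematic side)

Cell `pub-balaban`, rung (B)+1 sub-cell t4, lineage `b2b-balaban-t4-ne7b-p1` (row NE7b OWNER + CRUX PROVER; junction service for row NE7, ruling R-OWNER-149-1 (2)), generation 161.
Index `t4/b2b-balaban-t4-ne7b-p1/g161/INDEX.md`; memo `g161/records/SCOPING-G3.md`.
WHY.  The bordered Hessian of the constrained minimal action at a general small datum (✓ `NE7MinActHessianLagrangianAllData.minAct_hessian_lagrangian_allData`, ✓ `NE7MinActHessianHessForm`)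
minimises `w·hess U♯ X̃ X̃ − Dm(0)[D²𝒢(0)[X, X]]` over the lifts `X` of a coarse direction, `𝒢 = levelQ L N j U♯ ∘ chart_{U♯}`.  Any bound on the MULTIPLIER TERM `Dm(0)[D²𝒢(0)[X,X]]`
that is uniform in the level `j` (ROAD-G116 §6 (G3)) has to resolve `D²𝒢(0)` scale by scale: THIS FILE is the exact recursion that does so (pure calculus over landed smoothness theorems);
the one-step curvature `D²coord_W(0)` is then estimated once per level and the remaining tower `levelQ′` is linear.
WHAT ([folklore]; 0 def, 0 sorry; every `d`, every `U(n)`, `L ≥ 1`; hypotheses = row NE3-R2's multi-level small-field class at the base `W₁`: unitary, `(L·tower L M′ j)`-periodic,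
`SmallField W₁ x`, `LevelSmall d L j x`):
* §1 `levelQ_chart_zero_eq` — `levelQ L M′ 0 W₁ (chart_{W₁} Φ) = skewPR M′ (coord L M′ W₁ Φ)` (definitional); `levelQ_chart_succ_eventuallyEq` — near `Φ = 0`,
  `levelQ L M′ (j+1) W₁ (chart_{W₁} Φ) = levelQ L M′ j (cavg L W₁) (chart_{cavg L W₁} (coord L (L·tower L M′ j) W₁ Φ))` (✓ `eventually_cavg_chart_eq'`).
* §2 `fderiv_levelQ_chart` — `D𝒢_{j,W₁}(0) = levelQ′ L M′ j W₁` (✓ `hasStrictFDerivAt_levelQ`, as an equation of `fderiv`s).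
* §3 **`fderiv_fderiv_levelQ_chart_zero`** (base) and **`fderiv_fderiv_levelQ_chart_succ`** (step) — the two displayed identities (✓ `NE7SecondOrderChainRuleVec.fderiv_fderiv_comp_vec`,
  ✓ `NE7FibreStraightening.contDiffAt_levelQ`, ✓ `AveragingDeficitChartCalculus.contDiffAt_coord`).
* §4 `fderiv_fderiv_levelQ_chart_subtype` — the road's `𝒢` lives on `skewSub`: `D²(𝒢 ∘ ι)(0)[X,X′] = D²𝒢(0)[ιX, ιX′]` for the inclusion `ι : skewSub M → TDir M`
  (✓ `fderiv_fderiv_comp_clm_vec`), so §3 applies verbatim to the second derivatives displayed in ✓ p828683.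
HONEST FRAMING (page 1): calculus identities over landed kernel theorems; NO estimate here (the one-step kinematic letter and the `j`-uniform multiplier bound are separate files); OUR objects
(B7 (42) average `bavg`∕`cavg`, the exponential chart, row NE3-R2's `levelQ`∕`levelQ′`); nothing of Bałaban's asserted ([Balaban1985Averaging] (127)∕(134) context only: «Q_{j+1}(U₀, ηA) =
Q(Ū₀ʲ, Q_j(U₀, ηA))»); NOT NE7 as a spine node, NOT NE3; row NE7b NOT PRINTED ∕ NOT PROVED; spine 0∕9; finite T⁴ rung (B)+1 — NOT infinite volume, NOT mass gap, NOT BetaPertH, NOT Clay.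
-/

set_option autoImplicit false

open scoped BigOperators Matrix Matrix.Norms.L2Operator Topology
open NormedSpace Finset Set Filter

namespace Summit.QuantumFields.BalabanUV.T4Continuum.NE7ConstraintSecondDerivativeRecursion

open Literature.MathematicalPhysics.QuantumFieldTheory.Balaban1983to89
open B7Prop1Explicit B7Prop2Explicit
open T4AveragingDeficitWall (IsUnitaryCfg SmallField)
open T4AveragingDeficitWallBoundary (IsPeriodicCfg)
open AveragingDeficitTorusChart (TDir chart chart_zero)
open AveragingDeficitChartCalculus (cavg coord coord_zero contDiffAt_coord)
open AveragingDeficitFermat (isPeriodicCfg_cavg small512_of_liftSmall)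
open AveragingDeficitTwoLevelPrep (skewSub skewPR smallness_of_twoLevelSmall smallField_cavg cavg_isUnitaryCfg)
open AveragingDeficitMultiLevelPrep (tower cavgIter levelQ levelQ' levelQ_succ LevelSmall natCast_tower_succ ball_of_small eventually_cavg_chart_eq')
open AveragingDeficitMultiLevelFermat (hasStrictFDerivAt_levelQ)
open NE7FibreStraightening (contDiffAt_levelQ)
open NE7SecondOrderChainRuleVec (fderiv_fderiv_comp_vec fderiv_fderiv_comp_clm_vec)

noncomputable section

variable {d : ℕ} {n : Type*} [Fintype n] [DecidableEq n]

/-! ## §1 The tower recursion of the constraint map in the chart -/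

/-- **Base of the tower**: `levelQ L M′ 0 W₁ (chart_{W₁} Φ) = skewPR M′ (coord L M′ W₁ Φ)` — the two-level constraint map in the chart IS the `𝔲(N)` part of the chart
coordinates of the one-step average (both sides unfold to `skewPR (relLog (cavg W₁) (cavg (chart_{W₁} Φ)))`). [folklore] -/
theorem levelQ_chart_zero_eq (L M' : ℕ) [NeZero L] [NeZero M'] (W₁ : Site d → Fin d → (Matrix n n ℂ)ˣ) (Φ : TDir d n (L * tower L M' 0)) :
    levelQ L M' 0 W₁ (chart (ContinuousLinearMap.id ℝ (Matrix n n ℂ)) (L * tower L M' 0) W₁ Φ)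
      = skewPR M' (coord (ContinuousLinearMap.id ℝ (Matrix n n ℂ)) L M' W₁ Φ) := rfl

/-- **Step of the tower, near `Φ = 0`**: in the multi-level small-field class at `W₁`,
`levelQ L M′ (j+1) W₁ (chart_{W₁} Φ) = levelQ L M′ j (cavg L W₁) (chart_{cavg L W₁} (coord L (L·tower L M′ j) W₁ Φ))` eventually — the `(j+2)`-fold constraint map factors
through the chart coordinates of the one-step average (✓ `eventually_cavg_chart_eq'`: `cavg (chart_{W₁} Φ) = chart_{cavg W₁} (coord Φ)` near `0`).
[cite: Balaban1985Averaging, (127) p.37] -/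
theorem levelQ_chart_succ_eventuallyEq [Nonempty n] {L M' : ℕ} [NeZero L] [NeZero M'] (hL : 1 ≤ L) (j : ℕ)
    {W₁ : Site d → Fin d → (Matrix n n ℂ)ˣ} {x : ℝ} (hW₁ : IsUnitaryCfg W₁) (hW₁P : IsPeriodicCfg W₁ ((L : ℤ) * (tower L M' (j + 1) : ℕ)))
    (hx : 0 ≤ x) (hs : LevelSmall d L (j + 1) x) (hW₁x : SmallField W₁ x) :
    (fun Φ : TDir d n (L * tower L M' (j + 1)) =>
        levelQ L M' (j + 1) W₁ (chart (ContinuousLinearMap.id ℝ (Matrix n n ℂ)) (L * tower L M' (j + 1)) W₁ Φ))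
      =ᶠ[𝓝 0] fun Φ => levelQ L M' j (cavg L W₁)
          (chart (ContinuousLinearMap.id ℝ (Matrix n n ℂ)) (L * tower L M' j) (cavg L W₁)
            (coord (ContinuousLinearMap.id ℝ (Matrix n n ℂ)) L (L * tower L M' j) W₁ Φ)) := by
  have hball := ball_of_small hL hW₁ hx hs.1 hW₁x
  have hVP : IsPeriodicCfg W₁ ((L : ℤ) * (L * tower L M' j : ℕ)) := hW₁P
  exact (eventually_cavg_chart_eq' (ContinuousLinearMap.id ℝ (Matrix n n ℂ)) (M := L * tower L M' j) hVP hball).mono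
    fun Φ hΦ => by
      simp only [levelQ_succ, tower]
      rw [hΦ]

/-! ## §2 The first derivative, as an equation -/

/-- `D(levelQ L M′ j W₁ ∘ chart_{W₁})(0) = levelQ′ L M′ j W₁` (✓ `hasStrictFDerivAt_levelQ`). [folklore] -/
theorem fderiv_levelQ_chart [Nonempty n] {L M' : ℕ} [NeZero L] [NeZero M'] (hL : 1 ≤ L) (j : ℕ)
    {W₁ : Site d → Fin d → (Matrix n n ℂ)ˣ} {x : ℝ} (hW₁ : IsUnitaryCfg W₁) (hW₁P : IsPeriodicCfg W₁ ((L : ℤ) * (tower L M' j : ℕ)))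
    (hx : 0 ≤ x) (hs : LevelSmall d L j x) (hW₁x : SmallField W₁ x) :
    fderiv ℝ (fun Φ : TDir d n (L * tower L M' j) =>
        levelQ L M' j W₁ (chart (ContinuousLinearMap.id ℝ (Matrix n n ℂ)) (L * tower L M' j) W₁ Φ)) 0 = levelQ' L M' j W₁ :=
  (hasStrictFDerivAt_levelQ (M' := M') hL j hW₁ hW₁P hx hs hW₁x).hasFDerivAt.fderiv

/-- The averaged base is again in the multi-level small-field class (one level down): unitary, `(L·tower L M′ j)`-periodic, `SmallField (cavg L W₁) x′` with `0 ≤ x′` and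
`LevelSmall d L j x′` for the radius `x′ = prop1Radius d L x`, and the loops of (42) at `W₁` lie in the ball of the logarithm. [folklore] -/
theorem cavg_levelSmall [Nonempty n] {L M' : ℕ} [NeZero L] [NeZero M'] (hL : 1 ≤ L) (j : ℕ)
    {W₁ : Site d → Fin d → (Matrix n n ℂ)ˣ} {x : ℝ} (hW₁ : IsUnitaryCfg W₁) (hW₁P : IsPeriodicCfg W₁ ((L : ℤ) * (tower L M' (j + 1) : ℕ)))
    (hx : 0 ≤ x) (hs : LevelSmall d L (j + 1) x) (hW₁x : SmallField W₁ x) :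
    ∃ x' : ℝ, 0 ≤ x' ∧ LevelSmall d L j x' ∧ IsUnitaryCfg (cavg L W₁) ∧ IsPeriodicCfg (cavg L W₁) ((L : ℤ) * (tower L M' j : ℕ)) ∧ SmallField (cavg L W₁) x'
      ∧ ∀ (q : Site d) (κ : Fin d) (r : Fin d → Fin L), ‖((Wcx L W₁ q κ (boxVec L r) : (Matrix n n ℂ)ˣ) : Matrix n n ℂ) - 1‖ < 1 := by
  obtain ⟨hlift, hr0, -, -⟩ := smallness_of_twoLevelSmall (d := d) hL hx hs.1
  have h512 := small512_of_liftSmall hL hx hlift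
  have hball := ball_of_small hL hW₁ hx hs.1 hW₁x
  have hW₁P' : IsPeriodicCfg (cavg L W₁) ((L : ℤ) * (tower L M' j : ℕ)) := by
    have h := isPeriodicCfg_cavg L (tower L M' (j + 1)) hW₁P
    rw [natCast_tower_succ] at h
    exact h
  exact ⟨_, hr0, hs.2, cavg_isUnitaryCfg hL hW₁ hx h512 hW₁x, hW₁P', smallField_cavg hL hW₁ hx h512 hW₁x, hball⟩

/-! ## §3 The second derivative along the tower -/

/-- **BASE**: `D²(levelQ L M′ 0 W₁ ∘ chart_{W₁})(0)[ψ, ψ′] = skewPR M′ (D²coord_{W₁}(0)[ψ, ψ′])` — the skew projection is linear, so the curvature of the two-level constraint map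
is the curvature of the chart coordinates of the one-step average. [folklore] -/
theorem fderiv_fderiv_levelQ_chart_zero [Nonempty n] {L M' : ℕ} [NeZero L] [NeZero M'] (hL : 1 ≤ L)
    {W₁ : Site d → Fin d → (Matrix n n ℂ)ˣ} {x : ℝ} (hW₁ : IsUnitaryCfg W₁) (hx : 0 ≤ x) (hs : LevelSmall d L 0 x) (hW₁x : SmallField W₁ x)
    (ψ ψ' : TDir d n (L * tower L M' 0)) :
    fderiv ℝ (fderiv ℝ (fun Φ : TDir d n (L * tower L M' 0) =>
        levelQ L M' 0 W₁ (chart (ContinuousLinearMap.id ℝ (Matrix n n ℂ)) (L * tower L M' 0) W₁ Φ))) 0 ψ ψ'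
      = skewPR M' (fderiv ℝ (fderiv ℝ (coord (ContinuousLinearMap.id ℝ (Matrix n n ℂ)) L M' W₁)) 0 ψ ψ') := by
  have hball := ball_of_small hL hW₁ hx hs hW₁x
  have hcoord : ContDiffAt ℝ 2 (coord (ContinuousLinearMap.id ℝ (Matrix n n ℂ)) L M' W₁) 0 :=
    contDiffAt_coord (m := 2) (ContinuousLinearMap.id ℝ (Matrix n n ℂ)) L M' W₁ hball
  have hP : ContDiffAt ℝ 2 (fun y : TDir d n M' => skewPR (d := d) (n := n) M' y) (coord (ContinuousLinearMap.id ℝ (Matrix n n ℂ)) L M' W₁ 0) :=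
    (skewPR (d := d) (n := n) M').contDiff.contDiffAt
  have h := fderiv_fderiv_comp_vec (f := fun y : TDir d n M' => skewPR (d := d) (n := n) M' y)
    (Θ := coord (ContinuousLinearMap.id ℝ (Matrix n n ℂ)) L M' W₁) (x := 0) hP hcoord ψ ψ'
  have hD1 : fderiv ℝ (fun y : TDir d n M' => skewPR (d := d) (n := n) M' y) = fun _ => skewPR (d := d) (n := n) M' := by
    funext y; exact (skewPR (d := d) (n := n) M').fderiv
  have hD2 : fderiv ℝ (fderiv ℝ (fun y : TDir d n M' => skewPR (d := d) (n := n) M' y)) (coord (ContinuousLinearMap.id ℝ (Matrix n n ℂ)) L M' W₁ 0) = 0 := by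
    rw [hD1, fderiv_const_apply]
  rw [hD2, hD1] at h
  simp only [zero_apply, zero_add] at h
  -- the two-level constraint map in the chart IS `skewPR ∘ coord` (§1, definitional)
  show fderiv ℝ (fderiv ℝ (fun y : TDir d n (L * tower L M' 0) =>
      skewPR (d := d) (n := n) M' (coord (ContinuousLinearMap.id ℝ (Matrix n n ℂ)) L M' W₁ y))) 0 ψ ψ' = _
  exact h

/-- **STEP**: in the multi-level small-field class at `W₁` (level `j+1`), with `Ū = cavg L W₁`, `T = D coord_{W₁}(0)` (the linearised one-step average, ✓ `fderiv_coord_apply` = `pushDir`),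
`D²(levelQ L M′ (j+1) W₁ ∘ chart_{W₁})(0)[ψ, ψ′] = D²(levelQ L M′ j Ū ∘ chart_Ū)(0)[T ψ, T ψ′] + levelQ′ L M′ j Ū (D²coord_{W₁}(0)[ψ, ψ′])`.
[cite: Balaban1985Averaging, (127) p.37] -/
theorem fderiv_fderiv_levelQ_chart_succ [Nonempty n] {L M' : ℕ} [NeZero L] [NeZero M'] (hL : 1 ≤ L) (j : ℕ)
    {W₁ : Site d → Fin d → (Matrix n n ℂ)ˣ} {x : ℝ} (hW₁ : IsUnitaryCfg W₁) (hW₁P : IsPeriodicCfg W₁ ((L : ℤ) * (tower L M' (j + 1) : ℕ)))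
    (hx : 0 ≤ x) (hs : LevelSmall d L (j + 1) x) (hW₁x : SmallField W₁ x) (ψ ψ' : TDir d n (L * tower L M' (j + 1))) :
    fderiv ℝ (fderiv ℝ (fun Φ : TDir d n (L * tower L M' (j + 1)) =>
        levelQ L M' (j + 1) W₁ (chart (ContinuousLinearMap.id ℝ (Matrix n n ℂ)) (L * tower L M' (j + 1)) W₁ Φ))) 0 ψ ψ'
      = fderiv ℝ (fderiv ℝ (fun Φ' : TDir d n (L * tower L M' j) =>
            levelQ L M' j (cavg L W₁) (chart (ContinuousLinearMap.id ℝ (Matrix n n ℂ)) (L * tower L M' j) (cavg L W₁) Φ'))) 0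
          (fderiv ℝ (coord (ContinuousLinearMap.id ℝ (Matrix n n ℂ)) L (L * tower L M' j) W₁) 0 ψ)
          (fderiv ℝ (coord (ContinuousLinearMap.id ℝ (Matrix n n ℂ)) L (L * tower L M' j) W₁) 0 ψ')
        + levelQ' L M' j (cavg L W₁)
            (fderiv ℝ (fderiv ℝ (coord (ContinuousLinearMap.id ℝ (Matrix n n ℂ)) L (L * tower L M' j) W₁)) 0 ψ ψ') := by
  obtain ⟨x', hx', hs', hWu', hWP', hWx', hball⟩ := cavg_levelSmall (M' := M') hL j hW₁ hW₁P hx hs hW₁x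
  -- `C²`-smoothness of the two factors
  have hcoord : ContDiffAt ℝ 2 (coord (ContinuousLinearMap.id ℝ (Matrix n n ℂ)) L (L * tower L M' j) W₁) 0 :=
    contDiffAt_coord (m := 2) (ContinuousLinearMap.id ℝ (Matrix n n ℂ)) L (L * tower L M' j) W₁ hball
  have hG : ContDiffAt ℝ 2 (fun Φ' : TDir d n (L * tower L M' j) =>
      levelQ L M' j (cavg L W₁) (chart (ContinuousLinearMap.id ℝ (Matrix n n ℂ)) (L * tower L M' j) (cavg L W₁) Φ'))
      (coord (ContinuousLinearMap.id ℝ (Matrix n n ℂ)) L (L * tower L M' j) W₁ 0) := by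
    rw [coord_zero]
    exact contDiffAt_levelQ (m := 2) (M' := M') hL j hWu' hWP' hx' hs' hWx'
  -- the second derivative of the factorisation (§1), then the vector chain rule
  have hev := levelQ_chart_succ_eventuallyEq (M' := M') hL j hW₁ hW₁P hx hs hW₁x
  have hD := (hev.fderiv (𝕜 := ℝ)).fderiv_eq (𝕜 := ℝ)
  rw [hD]
  have h := fderiv_fderiv_comp_vec
    (f := fun Φ' : TDir d n (L * tower L M' j) =>
      levelQ L M' j (cavg L W₁) (chart (ContinuousLinearMap.id ℝ (Matrix n n ℂ)) (L * tower L M' j) (cavg L W₁) Φ'))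
    (Θ := coord (ContinuousLinearMap.id ℝ (Matrix n n ℂ)) L (L * tower L M' j) W₁) (x := 0) hG hcoord ψ ψ'
  rw [coord_zero, fderiv_levelQ_chart (M' := M') hL j hWu' hWP' hx' hs' hWx'] at h
  exact h

/-- The same STEP with the first derivatives named: `T = D coord_{W₁}(0)` and `D(levelQ L M′ j Ū ∘ chart_Ū)(0) = levelQ′ L M′ j Ū`, so that the outer first-order map of the
recursion is `levelQ′ L M′ (j+1) W₁ = levelQ′ L M′ j Ū ∘ T` (definitional). [folklore] -/
theorem levelQ'_succ_apply (L M' : ℕ) [NeZero L] [NeZero M'] (j : ℕ) (W₁ : Site d → Fin d → (Matrix n n ℂ)ˣ) (ψ : TDir d n (L * tower L M' (j + 1))) :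
    levelQ' L M' (j + 1) W₁ ψ
      = levelQ' L M' j (cavg L W₁) (fderiv ℝ (coord (ContinuousLinearMap.id ℝ (Matrix n n ℂ)) L (L * tower L M' j) W₁) 0 ψ) := rfl

/-! ## §4 The constraint map restricted to the skew directions (the road's `𝒢` on `skewSub`) -/

/-- **Restriction to `skewSub`**: for the inclusion `ι : skewSub M → TDir M` (a continuous linear map), `D²(𝒢 ∘ ι)(0)[X, X′] = D²𝒢(0)[ιX, ιX′]` — so the second derivatives
displayed in ✓ `NE7MinActHessianLagrangianAllData.minAct_hessian_lagrangian_allData` (domain `skewSub (L·tower L N j)`) obey §3 verbatim. [folklore] -/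
theorem fderiv_fderiv_levelQ_chart_subtype [Nonempty n] {L M' : ℕ} [NeZero L] [NeZero M'] (hL : 1 ≤ L) (j : ℕ)
    {W₁ : Site d → Fin d → (Matrix n n ℂ)ˣ} {x : ℝ} (hW₁ : IsUnitaryCfg W₁) (hW₁P : IsPeriodicCfg W₁ ((L : ℤ) * (tower L M' j : ℕ)))
    (hx : 0 ≤ x) (hs : LevelSmall d L j x) (hW₁x : SmallField W₁ x) (X X' : ↥(skewSub d n (L * tower L M' j))) :
    fderiv ℝ (fderiv ℝ (fun Φ : ↥(skewSub d n (L * tower L M' j)) =>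
        levelQ L M' j W₁ (chart (ContinuousLinearMap.id ℝ (Matrix n n ℂ)) (L * tower L M' j) W₁ (Φ : TDir d n (L * tower L M' j))))) 0 X X'
      = fderiv ℝ (fderiv ℝ (fun Φ : TDir d n (L * tower L M' j) =>
          levelQ L M' j W₁ (chart (ContinuousLinearMap.id ℝ (Matrix n n ℂ)) (L * tower L M' j) W₁ Φ))) 0
          (X : TDir d n (L * tower L M' j)) (X' : TDir d n (L * tower L M' j)) := by
  have hG : ContDiffAt ℝ 2 (fun Φ : TDir d n (L * tower L M' j) =>
      levelQ L M' j W₁ (chart (ContinuousLinearMap.id ℝ (Matrix n n ℂ)) (L * tower L M' j) W₁ Φ))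
      ((skewSub d n (L * tower L M' j)).subtypeL (0 : ↥(skewSub d n (L * tower L M' j)))) := by
    rw [Submodule.subtypeL_apply, Submodule.coe_zero]
    exact contDiffAt_levelQ (m := 2) (M' := M') hL j hW₁ hW₁P hx hs hW₁x
  have h := fderiv_fderiv_comp_clm_vec
    (f := fun Φ : TDir d n (L * tower L M' j) =>
      levelQ L M' j W₁ (chart (ContinuousLinearMap.id ℝ (Matrix n n ℂ)) (L * tower L M' j) W₁ Φ))
    ((skewSub d n (L * tower L M' j)).subtypeL) (x := (0 : ↥(skewSub d n (L * tower L M' j)))) hG X X'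
  simpa only [Submodule.subtypeL_apply, Submodule.coe_zero] using h

end

end Summit.QuantumFields.BalabanUV.T4Continuum.NE7ConstraintSecondDerivativeRecursion
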